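import Literature.Computability.QuantumComplexity.KeyDiagonalAveraging
import HarnessLib

/-!
# Oracle gates with extra query wires holding a classical prefix: slicing the oracle language

Topic `Literature/Computability/QuantumComplexity`; sequel of `KeyDiagonalAveraging.lean`. The XOR query gate of a
language `A` on `P + k` query wires, whose first `P` query wires sit on a register that the circuit keeps classical
with content `c`, acts — on that branch — exactly as the XOR query gate of the SLICED language
`A⟨c⟩ = {u | c ++ u ∈ A}` on the remaining `k` query wires (Nielsen–Chuang 2010, §6.1.1: the oracle
`|x⟩|q⟩ ↦ |x⟩|q ⊕ f(x)⟩` with part of `x` held fixed is the oracle of the restricted function). This is the semantic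
half of "re-targeting" the oracle gates of a circuit to a keyed / parametrised oracle: one circuit with the parameter
written on extra wires runs, branch by branch, the original circuit relative to the parameter's slice of the oracle
(Bennett–Bernstein–Brassard–Vazirani 1997, §4: oracle machines as subroutines with part of the query tape fixed;
Zhandry 2012, Thm. 3.1: the algorithm run on the member `h_key` of a hash family).

* `prefixSlice A c` — the language `{u | c ++ u ∈ A}`; `boolIndicator_prefixSlice`;
* `prefEmb p e h` — the wire embedding of the enlarged oracle gate: the `P` prefix wires `p`, then the `k + 1` wires
  `e` of the original gate (disjoint from `p`); `prefEmb_castAdd`, `prefEmb_natAdd`, `range_prefEmb`;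
* **`placeGate_oracleGate_prefEmb_apply`** — ENTRYWISE on the branch: for basis labels `x, z` reading `c` on the
  prefix wires, `placeGate (prefEmb p e h) (oracleGate A (P + k)) x z = placeGate e (oracleGate (prefixSlice A c̄) k) x z`
  (`c̄ = List.ofFn c`);
* **`placeGate_oracleGate_prefEmb_mulVec`** — hence on vectors supported on the branch `{z | z ∘ p = c}` the enlarged
  gate and the sliced gate act identically; together with `KeyDiagonal.placeGate_oracleGate` (the branch is preserved)
  this is what an induction over a gate list consumes.

Everything here is PROVED; two definitions (`prefixSlice`, `prefEmb`).

## References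

* M. A. Nielsen, I. L. Chuang, *Quantum Computation and Quantum Information*, CUP 2010, §6.1.1 (the quantum oracle
  `|x⟩|q⟩ ↦ |x⟩|q ⊕ f(x)⟩`), §4.3 (controlled operations act blockwise) [NielsenChuang2010].
* C. H. Bennett, E. Bernstein, G. Brassard, U. Vazirani, *Strengths and weaknesses of quantum computing*, SIAM J.
  Comput. 26 (1997) 1510–1523, §4 (oracle quantum Turing machines, subroutine calls) [BennettBernsteinBrassardVazirani1997].
* M. Zhandry, *Secure identity-based encryption in the quantum random oracle model*, CRYPTO 2012, Thm. 3.1 [Zhandry2012].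
-/

noncomputable section

namespace Literature.Computability.QuantumComplexity

open Cryptography Matrix Finset

variable {N P k : ℕ}

/-! ### The sliced language -/

/-- **The slice of a language at a prefix**: `prefixSlice A c = {u | c ++ u ∈ A}`.
[cite: NielsenChuang2010, §6.1.1 (the oracle of a function with part of its input fixed)] -/
def prefixSlice (A : Language Bool) (c : List Bool) : Language Bool :=
  ({u : List Bool | c ++ u ∈ A} : Set (List Bool))

/-- Membership in the slice. [cite: NielsenChuang2010, §6.1.1] -/
@[simp] theorem mem_prefixSlice (A : Language Bool) (c u : List Bool) : u ∈ prefixSlice A c ↔ c ++ u ∈ A := Iff.rfl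

/-- The indicator of the slice is the indicator of `A` on the extended query. [cite: NielsenChuang2010, §6.1.1] -/
theorem boolIndicator_prefixSlice (A : Language Bool) (c u : List Bool) :
    (prefixSlice A c).boolIndicator u = A.boolIndicator (c ++ u) := by
  by_cases h : c ++ u ∈ A
  · have h1 : (prefixSlice A c).boolIndicator u = true :=
      (Set.mem_iff_boolIndicator (prefixSlice A c : Set (List Bool)) u).1 h
    have h2 : A.boolIndicator (c ++ u) = true := (Set.mem_iff_boolIndicator (A : Set (List Bool)) (c ++ u)).1 h
    rw [h1, h2]
  · have h1 : (prefixSlice A c).boolIndicator u = false :=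
      (Set.notMem_iff_boolIndicator (prefixSlice A c : Set (List Bool)) u).1 h
    have h2 : A.boolIndicator (c ++ u) = false := (Set.notMem_iff_boolIndicator (A : Set (List Bool)) (c ++ u)).1 h
    rw [h1, h2]

/-! ### The wire embedding of the enlarged gate -/

/-- **The wires of the enlarged oracle gate**: first the `P` prefix wires `p`, then the `k + 1` wires `e` of the
original gate (query wires and, last, the answer wire); `p` and `e` are disjoint.
[cite: NielsenChuang2010, §4.3 (placing a gate on chosen wires)] -/
def prefEmb (p : Fin P ↪ Fin N) (e : Fin (k + 1) ↪ Fin N) (h : ∀ a b, p a ≠ e b) : Fin (P + (k + 1)) ↪ Fin N where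
  toFun := Fin.addCases (fun a => p a) (fun b => e b)
  inj' := by
    intro i j hij
    induction i using Fin.addCases with
    | left a =>
      induction j using Fin.addCases with
      | left a' =>
        simp only [Fin.addCases_left] at hij
        rw [p.injective hij]
      | right b' =>
        simp only [Fin.addCases_left, Fin.addCases_right] at hij
        exact absurd hij (h a b')
    | right b =>
      induction j using Fin.addCases with
      | left a' =>
        simp only [Fin.addCases_left, Fin.addCases_right] at hij
        exact absurd hij.symm (h a' b)
      | right b' =>
        simp only [Fin.addCases_right] at hij
        rw [e.injective hij]

variable (p : Fin P ↪ Fin N) (e : Fin (k + 1) ↪ Fin N) (h : ∀ a b, p a ≠ e b)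

/-- The prefix wires of the enlarged gate. [cite: NielsenChuang2010, §4.3 (wires of a placed gate)] -/
@[simp] theorem prefEmb_castAdd (a : Fin P) : prefEmb p e h (Fin.castAdd (k + 1) a) = p a := by
  simp [prefEmb]

/-- The original wires of the enlarged gate. [cite: NielsenChuang2010, §4.3 (wires of a placed gate)] -/
@[simp] theorem prefEmb_natAdd (b : Fin (k + 1)) : prefEmb p e h (Fin.natAdd P b) = e b := by
  simp [prefEmb]

/-- The enlarged embedding on a wire index below `P` is the prefix wire. [cite: NielsenChuang2010, §4.3 (wires of a placed gate)] -/
theorem prefEmb_apply_of_lt (i : Fin (P + (k + 1))) (hi : (i : ℕ) < P) : prefEmb p e h i = p ⟨i, hi⟩ := by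
  have e1 : Fin.castAdd (k + 1) (⟨i, hi⟩ : Fin P) = i := Fin.ext rfl
  have h1 := prefEmb_castAdd p e h ⟨i, hi⟩
  rwa [e1] at h1

/-- The range of the enlarged embedding is the union of the two ranges. [cite: NielsenChuang2010, §4.3 (wires of a placed gate)] -/
theorem mem_range_prefEmb_iff (i : Fin N) : i ∈ Set.range (prefEmb p e h) ↔ i ∈ Set.range p ∨ i ∈ Set.range e := by
  constructor
  · rintro ⟨j, rfl⟩
    induction j using Fin.addCases with
    | left a => exact Or.inl ⟨a, (prefEmb_castAdd p e h a).symm⟩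
    | right b => exact Or.inr ⟨b, (prefEmb_natAdd p e h b).symm⟩
  · rintro (⟨a, rfl⟩ | ⟨b, rfl⟩)
    · exact ⟨Fin.castAdd (k + 1) a, prefEmb_castAdd p e h a⟩
    · exact ⟨Fin.natAdd P b, prefEmb_natAdd p e h b⟩

/-- Query wire `castSucc (castAdd k a)` of the enlarged gate is the prefix wire `p a`. [cite: NielsenChuang2010, §4.3 (wires of a placed gate)] -/
theorem prefEmb_castSucc_castAdd (a : Fin P) :
    prefEmb p e h (Fin.castSucc (Fin.castAdd k a)) = p a := by
  have : (Fin.castSucc (Fin.castAdd k a) : Fin (P + (k + 1))) = Fin.castAdd (k + 1) a := Fin.ext rfl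
  rw [this, prefEmb_castAdd]

/-- Query wire `castSucc (natAdd P b)` of the enlarged gate is the original query wire `e (castSucc b)`. [cite: NielsenChuang2010, §4.3 (wires of a placed gate)] -/
theorem prefEmb_castSucc_natAdd (b : Fin k) :
    prefEmb p e h (Fin.castSucc (Fin.natAdd P b)) = e (Fin.castSucc b) := by
  have : (Fin.castSucc (Fin.natAdd P b) : Fin (P + (k + 1))) = Fin.natAdd P (Fin.castSucc b) := Fin.ext rfl
  rw [this, prefEmb_natAdd]

/-- The answer wire of the enlarged gate is the original answer wire. [cite: NielsenChuang2010, §4.3 (wires of a placed gate)] -/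
theorem prefEmb_last : prefEmb p e h (Fin.last (P + k)) = e (Fin.last k) := by
  have : (Fin.last (P + k) : Fin (P + (k + 1))) = Fin.natAdd P (Fin.last k) := Fin.ext rfl
  rw [this, prefEmb_natAdd]

/-! ### Entrywise slicing on the branch -/

/-- The off-range agreement conditions of the enlarged and of the original placement coincide for labels agreeing on
the prefix wires. [cite: NielsenChuang2010, §4.3 (wires of a placed gate)] -/
theorem agree_off_prefEmb_iff {x z : QReg N} (hxz : x ∘ p = z ∘ p) :
    (∀ i, i ∉ Set.range (prefEmb p e h) → x i = z i) ↔ (∀ i, i ∉ Set.range e → x i = z i) := by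
  constructor
  · intro H i hi
    by_cases hip : i ∈ Set.range p
    · obtain ⟨a, rfl⟩ := hip
      exact congrFun hxz a
    · exact H i (fun hmem => ((mem_range_prefEmb_iff p e h i).1 hmem).elim hip hi)
  · intro H i hi
    exact H i (fun hie => hi ((mem_range_prefEmb_iff p e h i).2 (Or.inr hie)))

/-- **Slicing, entrywise.** For basis labels `x, z` both reading `c` on the prefix wires, the entry of the enlarged
oracle gate of `A` equals the entry of the original-position oracle gate of the slice `prefixSlice A (List.ofFn c)`.
[cite: NielsenChuang2010, §6.1.1 (oracle with part of the query fixed)] -/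
theorem placeGate_oracleGate_prefEmb_apply (A : Language Bool) (c : QReg P) {x z : QReg N}
    (hx : x ∘ p = c) (hz : z ∘ p = c) :
    placeGate (prefEmb p e h) (oracleGate A (P + k)) x z =
      placeGate e (oracleGate (prefixSlice A (List.ofFn c)) k) x z := by
  have hxz : x ∘ p = z ∘ p := by rw [hx, hz]
  rw [placeGate_apply, placeGate_apply]
  by_cases hagree : ∀ i, i ∉ Set.range e → x i = z i
  · rw [if_pos ((agree_off_prefEmb_iff p e h hxz).2 hagree), if_pos hagree]
    -- the two oracle entries
    unfold oracleGate
    rw [Matrix.of_apply, Matrix.of_apply]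
    -- query agreement conditions
    have hq : (∀ i : Fin (P + k), (x ∘ prefEmb p e h) i.castSucc = (z ∘ prefEmb p e h) i.castSucc) ↔
        (∀ j : Fin k, (x ∘ e) j.castSucc = (z ∘ e) j.castSucc) := by
      constructor
      · intro H j
        have := H (Fin.natAdd P j)
        simp only [Function.comp_apply, prefEmb_castSucc_natAdd] at this
        simpa only [Function.comp_apply] using this
      · intro H i
        induction i using Fin.addCases with
        | left a =>
          simp only [Function.comp_apply, prefEmb_castSucc_castAdd]
          exact congrFun hxz a
        | right b =>
          simp only [Function.comp_apply, prefEmb_castSucc_natAdd]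
          simpa only [Function.comp_apply] using H b
    -- the query strings
    have hstr : (List.ofFn fun i : Fin (P + k) => (z ∘ prefEmb p e h) i.castSucc) =
        List.ofFn c ++ List.ofFn fun j : Fin k => (z ∘ e) j.castSucc := by
      rw [List.ofFn_add]
      congr 1
      · refine List.ofFn_inj.2 (funext fun a => ?_)
        simp only [Function.comp_apply]
        rw [prefEmb_apply_of_lt p e h _ (by simp)]
        exact congrFun hz a
      · refine List.ofFn_inj.2 (funext fun b => ?_)
        simp only [Function.comp_apply, prefEmb_castSucc_natAdd]
    have hlast : (x ∘ prefEmb p e h) (Fin.last (P + k)) = (x ∘ e) (Fin.last k) ∧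
        (z ∘ prefEmb p e h) (Fin.last (P + k)) = (z ∘ e) (Fin.last k) := by
      simp only [Function.comp_apply, prefEmb_last, and_self]
    rw [hstr, ← boolIndicator_prefixSlice, hlast.1, hlast.2]
    by_cases hcond : (∀ j : Fin k, (x ∘ e) j.castSucc = (z ∘ e) j.castSucc) ∧
        (x ∘ e) (Fin.last k) = ((z ∘ e) (Fin.last k) ^^
          (prefixSlice A (List.ofFn c)).boolIndicator (List.ofFn fun j : Fin k => (z ∘ e) j.castSucc))
    · rw [if_pos hcond, if_pos ⟨hq.2 hcond.1, hcond.2⟩]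
    · rw [if_neg hcond, if_neg (fun h' => hcond ⟨hq.1 h'.1, h'.2⟩)]
  · rw [if_neg (fun H => hagree ((agree_off_prefEmb_iff p e h hxz).1 H)), if_neg hagree]

/-- **Slicing on branch-supported vectors.** If `v` is supported on the branch `{z | z ∘ p = c}`, the enlarged oracle
gate of `A` and the original-position oracle gate of the slice act identically on `v`.
[cite: NielsenChuang2010, §6.1.1] [cite: BennettBernsteinBrassardVazirani1997, §4 (oracle subroutines with a fixed query prefix)] -/
theorem placeGate_oracleGate_prefEmb_mulVec (A : Language Bool) (c : QReg P) {v : QReg N → ℂ}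
    (hv : ∀ z, z ∘ p ≠ c → v z = 0) :
    placeGate (prefEmb p e h) (oracleGate A (P + k)) *ᵥ v =
      placeGate e (oracleGate (prefixSlice A (List.ofFn c)) k) *ᵥ v := by
  funext x
  rw [Matrix.mulVec, Matrix.mulVec, dotProduct, dotProduct]
  refine Finset.sum_congr rfl fun z _ => ?_
  by_cases hzc : z ∘ p = c
  · by_cases hxc : x ∘ p = c
    · rw [placeGate_oracleGate_prefEmb_apply p e h A c hxc hzc]
    · -- both entries vanish: the enlarged gate keeps the prefix (its answer wire is off `p`), the original gate is off `p`
      have hne : x ∘ p ≠ z ∘ p := by rw [hzc]; exact hxc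
      have h1 : placeGate (prefEmb p e h) (oracleGate A (P + k)) x z = 0 :=
        KeyDiagonal.placeGate_oracleGate (s := p) (k := P + k) (prefEmb p e h :) A
          (fun a => by rw [prefEmb_last]; exact fun h' => h a (Fin.last k) h'.symm) x z hne
      have h2 : placeGate e (oracleGate (prefixSlice A (List.ofFn c)) k) x z = 0 :=
        KeyDiagonal.placeGate_of_forall_ne (s := p) e _ (fun b a h' => h a b h'.symm) x z hne
      rw [h1, h2]
  · rw [hv z hzc, mul_zero, mul_zero]

end Literature.Computability.QuantumComplexity

end
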